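import Summits.CriticalPhenomena.Ising3DConformalLimit.Theses.LinkingParityCircles
import Summits.CriticalPhenomena.Ising3DConformalLimit.Theorems.MoebiusLimitExists.Negative.FreeTranslations
import Literature.Probability.LatticeModels.HighDimPointwiseTriviality
import Literature.Probability.LatticeModels.CriticalUrsellFourFloor
import Literature.Probability.LatticeModels.CriticalBlockMoments
import Literature.Probability.LatticeModels.CriticalTwoPointLower
import Literature.Probability.LatticeModels.CriticalScalingDimension
import Summits.CriticalPhenomena.Ising3DConformalLimit.Theorems.IsingEuclidUpgradeR4NonGaussianFatStep
import Summits.CriticalPhenomena.Ising3DConformalLimit.Theorems.MoebiusLimitOfTwoPointLaw.Negative.EvenReductionSharp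
import HarnessLib

/-!
# Crux `LinkingParityCircles.SpinRatioMoebius` (stmt-CriticalPhenomena-4530), line `registered` —
# preliminaries for stub `stub_twoPointOfRatioLimit` (pinned two-point limit from the 4-point ratio limit)

Tools, all elementary:

* `tendstoLocallyUniformlyOn_comp_of_approx` — locally uniform convergence `F δ → f` on an open set of a
  proper metric space survives composition with maps `c' δ` that approximate a continuous `c` uniformly
  (`dist (c' δ y) (c y) → 0` uniformly in `y`), the limit being `f ∘ c` (uniform continuity of `f` on a
  compact thickening);
* `tendstoUniformlyOn_ratio_sq` — the hand-rolled uniform limit algebra for `K² = B/A` on a compact set;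
* exact lattice facts at mesh `δ`: the pinned point `δ • ⌊1/δ⌋ eᵢ` has lattice image `⌊1/δ⌋ eᵢ`, the
  4-point pairing ratio at the two auxiliary configurations `(0, δk, u, u + δk)` and `(0, u, δk, u + δk)`
  (`criticalCorr_translate`, `criticalCorr_comp_equiv_eq`), and the identity
  `Q^δ_2(0,u,δk,u+δk) · ⟨σ₀σ_k⟩² = Q^δ_2(0,δk,u,u+δk) · ⟨σ₀σ_{[u/δ]}⟩²` (both sides are `⟨σ₀σ_kσ_Uσ_{U+k}⟩`);
* `one_le_pairingRatio_two` — GKS II (`criticalCorr_two_mul_two_le_four`): `Q^δ_2 ≥ 1` at injective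
  lattice images, and lattice images of a non-coincident configuration are eventually injective.

References: S. Friedli, Y. Velenik (CUP 2017) Thm. 3.17, Thm. 3.20 (GKS); H. Duminil-Copin (2019) Thm. 4.8.
-/

noncomputable section

namespace Summit.CriticalPhenomena.Ising3DConformalLimit.Cruxes.SpinRatioMoebius.Birth

open Literature.Probability.LatticeModels Filter Set Metric
open Summit.CriticalPhenomena.Ising3DConformalLimit.MoebiusLimitExistsNegative
open Summit.CriticalPhenomena.Ising3DConformalLimit.Cruxes.IsingEuclidUpgradeR4NonGaussian.FreeCovarianceDeltaDichotomy
  (criticalCorr_two_pos')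
open Summit.CriticalPhenomena.Ising3DConformalLimit.Theorems.MoebiusLimitOfTwoPointLaw.Negative
  (latticeApprox_smul tendsto_div_const_nhdsGT)
open scoped Topology

/-! ## §A Locally uniform convergence under uniformly approximating reparametrisations -/

/-- **Perturbed composition.** If `F i → f` locally uniformly on an open set `s` of a proper metric space,
`f` is continuous on `s`, `c` is continuous on an open `t` with `c(t) ⊆ s`, and the maps `c' i` approximate
`c` uniformly on `t` along the filter, then `F i ∘ c' i → f ∘ c` locally uniformly on `t`. [folklore] -/
theorem tendstoLocallyUniformlyOn_comp_of_approx {X Y ι : Type*} [PseudoMetricSpace X] [ProperSpace X]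
    [TopologicalSpace Y] [LocallyCompactSpace Y] {p : Filter ι} {F : ι → X → ℝ} {f : X → ℝ} {s : Set X}
    (hs : IsOpen s) (hF : TendstoLocallyUniformlyOn F f p s) (hf : ContinuousOn f s) {t : Set Y}
    (ht : IsOpen t) {c : Y → X} (hc : ContinuousOn c t) (hct : MapsTo c t s) {c' : ι → Y → X}
    (happ : ∀ ε > 0, ∀ᶠ i in p, ∀ y ∈ t, dist (c' i y) (c y) < ε) :
    TendstoLocallyUniformlyOn (fun i y => F i (c' i y)) (f ∘ c) p t := by
  rw [tendstoLocallyUniformlyOn_iff_forall_isCompact ht]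
  intro K hKt hK
  have hcK : IsCompact (c '' K) := hK.image_of_continuousOn (hc.mono hKt)
  have hcKs : c '' K ⊆ s := by
    rintro _ ⟨y, hy, rfl⟩; exact hct (hKt hy)
  obtain ⟨r, hr, hrs⟩ := hcK.exists_cthickening_subset_open hs hcKs
  have hK' : IsCompact (cthickening r (c '' K)) := hcK.cthickening
  have hunif : TendstoUniformlyOn F f p (cthickening r (c '' K)) :=
    (tendstoLocallyUniformlyOn_iff_forall_isCompact hs).1 hF _ hrs hK'
  have huc : UniformContinuousOn f (cthickening r (c '' K)) :=
    hK'.uniformContinuousOn_of_continuous (hf.mono hrs)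
  rw [Metric.tendstoUniformlyOn_iff]
  intro ε hε
  rw [Metric.uniformContinuousOn_iff] at huc
  obtain ⟨η, hη, hηf⟩ := huc (ε / 2) (by positivity)
  have h1 := (Metric.tendstoUniformlyOn_iff.1 hunif) (ε / 2) (by positivity)
  have h2 := happ (min η r) (lt_min hη hr)
  filter_upwards [h1, h2] with i hi hi' y hy
  have hcy : c y ∈ cthickening r (c '' K) := self_subset_cthickening _ ⟨y, hy, rfl⟩
  have hd : dist (c' i y) (c y) < min η r := hi' y (hKt hy)
  have hc'y : c' i y ∈ cthickening r (c '' K) :=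
    mem_cthickening_of_dist_le (c' i y) (c y) r (c '' K) ⟨y, hy, rfl⟩ ((lt_of_lt_of_le hd (min_le_right _ _)).le)
  have hfc : dist (f (c y)) (f (c' i y)) < ε / 2 :=
    hηf _ hcy _ hc'y (by rw [dist_comm]; exact lt_of_lt_of_le hd (min_le_left _ _))
  calc dist ((f ∘ c) y) (F i (c' i y))
      ≤ dist (f (c y)) (f (c' i y)) + dist (f (c' i y)) (F i (c' i y)) := dist_triangle _ _ _
    _ < ε / 2 + ε / 2 := add_lt_add hfc (hi _ hc'y)
    _ = ε := by ring

/-- Locally uniform convergence is insensitive to changing the approximants on an eventual set of indices.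
[folklore] -/
theorem TendstoLocallyUniformlyOn.congr_eventually {X ι : Type*} [TopologicalSpace X] {p : Filter ι}
    {F G : ι → X → ℝ} {f : X → ℝ} {s : Set X} (hF : TendstoLocallyUniformlyOn F f p s)
    (hFG : ∀ᶠ i in p, EqOn (F i) (G i) s) : TendstoLocallyUniformlyOn G f p s := by
  intro u hu x hx
  obtain ⟨t, ht, hev⟩ := hF u hu x hx
  refine ⟨t ∩ s, inter_mem ht self_mem_nhdsWithin, ?_⟩
  filter_upwards [hev, hFG] with i hi hi' y hy
  rw [← hi' hy.2]
  exact hi y hy.1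

/-- **Uniform limit algebra for `K² = B / A`.** If `A_i → a`, `B_i → b` uniformly on `C`, `1 ≤ a`, `|b| ≤ M`,
and eventually `K_i² · A_i = B_i` on `C`, then `K_i² → b / a` uniformly on `C`. [folklore] -/
theorem tendstoUniformlyOn_ratio_sq {X ι : Type*} {p : Filter ι} {A B Ksq : ι → X → ℝ} {a b : X → ℝ}
    {C : Set X} (hA : TendstoUniformlyOn A a p C) (hB : TendstoUniformlyOn B b p C)
    (ha : ∀ y ∈ C, 1 ≤ a y) {M : ℝ} (hM0 : 0 ≤ M) (hM : ∀ y ∈ C, |b y| ≤ M)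
    (hid : ∀ᶠ i in p, ∀ y ∈ C, Ksq i y * A i y = B i y) :
    TendstoUniformlyOn Ksq (fun y => b y / a y) p C := by
  rw [Metric.tendstoUniformlyOn_iff]
  intro ε hε
  -- choose `η ≤ 1/2` with `2η(M + 1) < ε`
  set η : ℝ := min (1 / 2) (ε / (2 * (M + 2))) with hη
  have hη0 : 0 < η := lt_min (by norm_num) (by positivity)
  have hη1 : η ≤ 1 / 2 := min_le_left _ _
  have hη2 : η ≤ ε / (2 * (M + 2)) := min_le_right _ _
  have h1 := (Metric.tendstoUniformlyOn_iff.1 hA) η hη0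
  have h2 := (Metric.tendstoUniformlyOn_iff.1 hB) η hη0
  filter_upwards [h1, h2, hid] with i hiA hiB hiid y hy
  have hAy := hiA y hy
  have hBy := hiB y hy
  rw [Real.dist_eq] at hAy hBy ⊢
  have hay := ha y hy
  have hAa := abs_sub_lt_iff.1 hAy
  have hAlow : 1 / 2 ≤ A i y := by linarith [hAa.1, hAa.2]
  have hApos : 0 < A i y := by linarith
  have hapos : 0 < a y := by linarith
  have hK : Ksq i y = B i y / A i y := by
    rw [← hiid y hy, mul_div_cancel_right₀ _ hApos.ne']
  rw [hK]
  have key : b y / a y - B i y / A i y = (b y * (A i y - a y) + a y * (b y - B i y)) / (a y * A i y) := by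
    field_simp
    ring
  rw [key, abs_div, abs_of_pos (mul_pos hapos hApos)]
  have hnum : |b y * (A i y - a y) + a y * (b y - B i y)| ≤ M * η + a y * η := by
    calc |b y * (A i y - a y) + a y * (b y - B i y)|
        ≤ |b y * (A i y - a y)| + |a y * (b y - B i y)| := abs_add_le _ _
      _ = |b y| * |A i y - a y| + a y * |b y - B i y| := by
          rw [abs_mul, abs_mul, abs_of_pos hapos]
      _ ≤ M * η + a y * η := by
          have e1 : |A i y - a y| ≤ η := by rw [abs_sub_comm]; exact hAy.le
          have e2 : |b y - B i y| ≤ η := hBy.le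
          have e3 := hM y hy
          gcongr
  have hstep : |b y * (A i y - a y) + a y * (b y - B i y)| / (a y * A i y) ≤ (M * η + a y * η) / (a y * (1 / 2)) :=
    div_le_div₀ (by positivity) hnum (by positivity) (mul_le_mul_of_nonneg_left hAlow hapos.le)
  refine lt_of_le_of_lt hstep ?_
  rw [div_lt_iff₀ (by positivity)]
  -- `Mη + aη < ε a / 2`, using `a ≥ 1`, `η(2(M+2)) ≤ ε`
  have h3 : η * (2 * (M + 2)) ≤ ε := (le_div_iff₀ (by positivity)).1 hη2
  nlinarith [mul_le_mul_of_nonneg_left hay hM0, mul_le_mul_of_nonneg_left hay hε.le]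

/-! ## §B Exact lattice facts at mesh `δ` -/

/-- `[(p + δ•k)/δ] = [p/δ] + k` for a lattice vector `k`. [folklore] -/
theorem latticeApprox_add_mesh_smul' {δ : ℝ} (hδ : 0 < δ) (p : EuclideanSpace ℝ (Fin 3)) (k : Site 3) :
    latticeApprox δ (p + δ • siteVec k) = latticeApprox δ p + k := by
  funext j
  simp only [latticeApprox_apply, PiLp.add_apply, PiLp.smul_apply, siteVec_apply, smul_eq_mul, Pi.add_apply]
  rw [add_div, mul_div_cancel_left₀ _ hδ.ne', Int.floor_add_intCast]

/-- `[(δ•k)/δ] = k`. [folklore] -/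
theorem latticeApprox_mesh_smul {δ : ℝ} (hδ : 0 < δ) (k : Site 3) :
    latticeApprox δ (δ • siteVec k) = k := by
  have h := latticeApprox_add_mesh_smul' hδ 0 k
  rwa [zero_add, latticeApprox_zero, zero_add] at h

/-- `⟨σ_kσ_{U+k}⟩ = ⟨σ₀σ_U⟩`. [cite: FriedliVelenik2017, Thm. 3.17] -/
theorem criticalCorr_two_shift (k U : Site 3) :
    criticalCorr 3 2 ![k, U + k] = criticalCorr 3 2 ![0, U] := by
  have h : (![k, U + k] : Fin 2 → Site 3) = fun i => (![0, U] : Fin 2 → Site 3) i + k := by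
    funext i; fin_cases i
    · simp
    · rfl
  rw [h, criticalCorr_translate]

/-- `⟨σ_Uσ_{U+k}⟩ = ⟨σ₀σ_k⟩`. [cite: FriedliVelenik2017, Thm. 3.17] -/
theorem criticalCorr_two_shift' (k U : Site 3) :
    criticalCorr 3 2 ![U, U + k] = criticalCorr 3 2 ![0, k] := by
  rw [add_comm]; exact criticalCorr_two_shift U k

/-- The 4-point pairing ratio written out (`Fin.castAdd 2 j = j`, `Fin.natAdd 2 j = 2 + j`). [folklore] -/
theorem pairingRatio_two_apply (δ : ℝ) (x : Fin (2 + 2) → EuclideanSpace ℝ (Fin 3)) :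
    criticalCorr 3 (2 + 2) (fun i => latticeApprox δ (x i)) /
        ∏ j : Fin 2, criticalCorr 3 2 ![latticeApprox δ (x (Fin.castAdd 2 j)), latticeApprox δ (x (Fin.natAdd 2 j))] =
      criticalCorr 3 4 ![latticeApprox δ (x 0), latticeApprox δ (x 1), latticeApprox δ (x 2), latticeApprox δ (x 3)] /
        (criticalCorr 3 2 ![latticeApprox δ (x 0), latticeApprox δ (x 2)] *
          criticalCorr 3 2 ![latticeApprox δ (x 1), latticeApprox δ (x 3)]) := by
  have h4 : (fun i => latticeApprox δ (x i)) =
      ![latticeApprox δ (x 0), latticeApprox δ (x 1), latticeApprox δ (x 2), latticeApprox δ (x 3)] := by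
    funext i; fin_cases i <;> rfl
  rw [h4, Fin.prod_univ_two]
  rfl

/-- Lattice image of the auxiliary configuration `A = (0, δk, u, u + δk)`: pairing ratio
`⟨σ₀σ_kσ_Uσ_{U+k}⟩ / ⟨σ₀σ_U⟩²`. [folklore] -/
theorem pairingRatio_two_configA {δ : ℝ} (hδ : 0 < δ) (k : Site 3) (u : EuclideanSpace ℝ (Fin 3)) :
    criticalCorr 3 (2 + 2) (fun i => latticeApprox δ ((![0, δ • siteVec k, u, u + δ • siteVec k] :
        Fin (2 + 2) → EuclideanSpace ℝ (Fin 3)) i)) /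
        ∏ j : Fin 2, criticalCorr 3 2 ![latticeApprox δ ((![0, δ • siteVec k, u, u + δ • siteVec k] :
          Fin (2 + 2) → EuclideanSpace ℝ (Fin 3)) (Fin.castAdd 2 j)),
          latticeApprox δ ((![0, δ • siteVec k, u, u + δ • siteVec k] :
          Fin (2 + 2) → EuclideanSpace ℝ (Fin 3)) (Fin.natAdd 2 j))] =
      criticalCorr 3 4 ![0, k, latticeApprox δ u, latticeApprox δ u + k] /
        (criticalCorr 3 2 ![0, latticeApprox δ u] * criticalCorr 3 2 ![0, latticeApprox δ u]) := by
  rw [pairingRatio_two_apply]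
  simp only [Matrix.cons_val_zero, Matrix.cons_val_one, Matrix.cons_val]
  rw [latticeApprox_zero, latticeApprox_mesh_smul hδ, latticeApprox_add_mesh_smul' hδ, criticalCorr_two_shift]

/-- Lattice image of the auxiliary configuration `B = (0, u, δk, u + δk)`: pairing ratio
`⟨σ₀σ_kσ_Uσ_{U+k}⟩ / ⟨σ₀σ_k⟩²`. [folklore] -/
theorem pairingRatio_two_configB {δ : ℝ} (hδ : 0 < δ) (k : Site 3) (u : EuclideanSpace ℝ (Fin 3)) :
    criticalCorr 3 (2 + 2) (fun i => latticeApprox δ ((![0, u, δ • siteVec k, u + δ • siteVec k] :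
        Fin (2 + 2) → EuclideanSpace ℝ (Fin 3)) i)) /
        ∏ j : Fin 2, criticalCorr 3 2 ![latticeApprox δ ((![0, u, δ • siteVec k, u + δ • siteVec k] :
          Fin (2 + 2) → EuclideanSpace ℝ (Fin 3)) (Fin.castAdd 2 j)),
          latticeApprox δ ((![0, u, δ • siteVec k, u + δ • siteVec k] :
          Fin (2 + 2) → EuclideanSpace ℝ (Fin 3)) (Fin.natAdd 2 j))] =
      criticalCorr 3 4 ![0, k, latticeApprox δ u, latticeApprox δ u + k] /
        (criticalCorr 3 2 ![0, k] * criticalCorr 3 2 ![0, k]) := by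
  rw [pairingRatio_two_apply]
  simp only [Matrix.cons_val_zero, Matrix.cons_val_one, Matrix.cons_val]
  rw [latticeApprox_zero, latticeApprox_mesh_smul hδ, latticeApprox_add_mesh_smul' hδ, criticalCorr_two_shift',
    criticalCorr_four_swap_middle]

/-- The pins along different axes agree: `⟨σ₀σ_{n eᵢ}⟩ = ⟨σ₀σ_{n e₀}⟩` (coordinate permutation symmetry of
`⟨·⟩⁺`, Friedli–Velenik Exercise 3.14). [cite: FriedliVelenik2017, Exercise 3.14, p. 115] -/
theorem criticalCorr_two_pin (i : Fin 3) (n : ℤ) :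
    criticalCorr 3 2 ![0, Pi.single i n] = criticalCorr 3 2 ![0, Pi.single 0 n] := by
  by_cases hi : i = 0
  · subst hi; rfl
  rw [criticalCorr_two_pair, criticalCorr_two_pair, sub_zero, sub_zero]
  have h : (Pi.single i n : Site 3) = fun j => (Pi.single 0 n : Site 3) (Equiv.swap (0 : Fin 3) i j) := by
    funext j
    simp only [Pi.single_apply, Equiv.swap_apply_eq_iff, Equiv.swap_apply_left]
  show twoPointPlus 3 (criticalBeta 3) (Pi.single i n) = twoPointPlus 3 (criticalBeta 3) (Pi.single 0 n)
  rw [h]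
  exact twoPointPlus_perm_invariant_holds (criticalBeta_nonneg 3) (Equiv.swap 0 i) (Pi.single 0 n)

/-! ## §C GKS: the 4-point pairing ratio is `≥ 1`, hence so is every ratio limit -/

/-- Lattice images of a non-coincident configuration are eventually (as `δ → 0⁺`) injective. [folklore] -/
theorem eventually_injective_latticeApprox {n : ℕ} {x : Fin n → EuclideanSpace ℝ (Fin 3)}
    (hx : x ∈ NonCoincident 3 n) :
    ∀ᶠ δ in 𝓝[>] (0:ℝ), Function.Injective (fun i => latticeApprox δ (x i)) := by
  have key : ∀ i j, i ≠ j → ∀ᶠ δ in 𝓝[>] (0:ℝ), latticeApprox δ (x i) ≠ latticeApprox δ (x j) := by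
    intro i j hij
    have hne : x i ≠ x j := fun h => hij ((mem_nonCoincident x).1 hx h)
    obtain ⟨c, hc⟩ : ∃ c, x i c ≠ x j c := by
      by_contra h
      push Not at h
      exact hne (PiLp.ext h)
    have hd : 0 < |x i c - x j c| := abs_pos.2 (sub_ne_zero.2 hc)
    filter_upwards [Ioo_mem_nhdsGT hd] with δ hδ heq
    have h1 : ⌊x i c / δ⌋ = ⌊x j c / δ⌋ := by
      have := congr_fun heq c
      simpa [latticeApprox_apply] using this
    have h2 := Int.abs_sub_lt_one_of_floor_eq_floor h1
    rw [← sub_div, abs_div, abs_of_pos hδ.1, div_lt_one hδ.1] at h2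
    linarith [hδ.2]
  have hall : ∀ᶠ δ in 𝓝[>] (0:ℝ), ∀ i j, i ≠ j → latticeApprox δ (x i) ≠ latticeApprox δ (x j) := by
    refine Filter.eventually_all.2 fun i => Filter.eventually_all.2 fun j => ?_
    by_cases h : i = j
    · exact Filter.Eventually.of_forall fun δ hij => absurd h hij
    · exact (key i j h).mono fun δ hδ _ => hδ
  filter_upwards [hall] with δ hδ i j heq
  by_contra hij
  exact hδ i j hij heq

/-- **GKS II for the 4-point pairing ratio**: `⟨σ_aσ_bσ_cσ_d⟩ ≥ ⟨σ_aσ_c⟩⟨σ_bσ_d⟩` at distinct lattice points, i.e.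
`Q ≥ 1`. [cite: FriedliVelenik2017, Thm. 3.20, eq. (3.22), p. 109] -/
theorem one_le_pairingRatio_two {y : Fin 4 → Site 3} (hy : Function.Injective y) :
    1 ≤ criticalCorr 3 4 y / (criticalCorr 3 2 ![y 0, y 2] * criticalCorr 3 2 ![y 1, y 3]) := by
  rw [le_div_iff₀ (mul_pos (criticalCorr_two_pos' _ _) (criticalCorr_two_pos' _ _)), one_mul]
  have hperm : (![y 0, y 2, y 1, y 3] : Fin 4 → Site 3) = y ∘ ⇑(Equiv.swap (1 : Fin 4) 2) := by
    funext i; fin_cases i <;> rfl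
  have hy' : Function.Injective (![y 0, y 2, y 1, y 3] : Fin 4 → Site 3) := by
    rw [hperm]; exact hy.comp (Equiv.injective _)
  have h := criticalCorr_two_mul_two_le_four (d := 3) le_rfl hy'
  have e0 : (![y 0, y 2, y 1, y 3] : Fin 4 → Site 3) 0 = y 0 := rfl
  have e1 : (![y 0, y 2, y 1, y 3] : Fin 4 → Site 3) 1 = y 2 := rfl
  have e2 : (![y 0, y 2, y 1, y 3] : Fin 4 → Site 3) 2 = y 1 := rfl
  have e3 : (![y 0, y 2, y 1, y 3] : Fin 4 → Site 3) 3 = y 3 := rfl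
  rw [e0, e1, e2, e3, hperm, criticalCorr_comp_equiv_eq] at h
  exact h

/-- For a non-coincident configuration the 4-point pairing ratio is eventually `≥ 1`. [folklore] -/
theorem eventually_one_le_pairingRatio_two {x : Fin (2 + 2) → EuclideanSpace ℝ (Fin 3)}
    (hx : x ∈ NonCoincident 3 (2 + 2)) :
    ∀ᶠ δ in 𝓝[>] (0:ℝ), 1 ≤ criticalCorr 3 (2 + 2) (fun i => latticeApprox δ (x i)) /
      ∏ j : Fin 2, criticalCorr 3 2 ![latticeApprox δ (x (Fin.castAdd 2 j)), latticeApprox δ (x (Fin.natAdd 2 j))] := by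
  filter_upwards [eventually_injective_latticeApprox hx] with δ hδ
  rw [pairingRatio_two_apply]
  have h4 : (![latticeApprox δ (x 0), latticeApprox δ (x 1), latticeApprox δ (x 2), latticeApprox δ (x 3)] :
      Fin 4 → Site 3) = fun i => latticeApprox δ (x i) := by
    funext i; fin_cases i <;> rfl
  have h := one_le_pairingRatio_two (y := fun i => latticeApprox δ (x i)) hδ
  rw [h4]
  exact h

/-- Hence every locally uniform limit of the 4-point pairing ratio is `≥ 1` on the locus. [folklore] -/
theorem one_le_ratioLimit_two :
    ∀ {q4 : (Fin (2 + 2) → EuclideanSpace ℝ (Fin 3)) → ℝ}, TendstoLocallyUniformlyOn (fun (δ : ℝ) (x : Fin (2 + 2) → EuclideanSpace ℝ (Fin 3)) => Literature.Probability.LatticeModels.criticalCorr 3 (2 + 2) (fun i => Literature.Probability.LatticeModels.latticeApprox δ (x i)) / ∏ j : Fin 2, Literature.Probability.LatticeModels.criticalCorr 3 2 ![Literature.Probability.LatticeModels.latticeApprox δ (x (Fin.castAdd 2 j)), Literature.Probability.LatticeModels.latticeApprox δ (x (Fin.natAdd 2 j))]) q4 (nhdsWithin 0 (Set.Ioi 0))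 (Literature.Probability.LatticeModels.NonCoincident 3 (2 + 2)) → ∀ {x : Fin (2 + 2) → EuclideanSpace ℝ (Fin 3)}, x ∈ Literature.Probability.LatticeModels.NonCoincident 3 (2 + 2) → 1 ≤ q4 x :=
  fun h4 _ hx => ge_of_tendsto (h4.tendsto_at hx) (eventually_one_le_pairingRatio_two hx)

end Summit.CriticalPhenomena.Ising3DConformalLimit.Cruxes.SpinRatioMoebius.Birth

end
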